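import Mathlib
import Literature.Combinatorics.Enumerative.BregmanMinc

/-!
# `DivisionGap.PerMultiplesHard` (stmt-ValiantsHypothesis-5068), line `uncharged-face-walk`:
stub `stub_logFactorialJensen` — Jensen for the Brégman exponent `γ(d) = log (d !) / d`

For integers `d_b ≥ 1` (`b < u`) with `∑_b d_b ≤ u · D` and `D ≥ 1`:

  `∑_b log (d_b !) / d_b ≤ u · log (D !) / D`   (`stub_logFactorialJensen`).

Proof.  Write `γ(d) = log (d !) / d` and `Δ_d = γ(d+1) − γ(d)`.

* CONCAVITY on `d ≥ 1` (`log_factorial_div_gap_succ_le`): `Δ_{d+1} ≤ Δ_d` for `d ≥ 1`.  Clearing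
  the denominators `d (d+1) (d+2)` and using `log ((d+1) !) = log (d+1) + log (d !)` this is
  `2 log (d !) ≤ d (d+3) log (d+1) − d (d+1) log (d+2)` (`two_mul_log_factorial_le`), which holds
  for every `d : ℕ` by induction: the difference of the two sides increases by
  `(d+1) (d+2) (2 log (d+2) − log (d+1) − log (d+3)) ≥ 0` (`(d+1)(d+3) ≤ (d+2)²`) when `d` is
  replaced by `d+1`, and both sides vanish at `d = 0`.
* DISCRETE JENSEN via the tangent line (`le_tangent_of_gap_succ_le`, `sum_le_card_mul_of_tangent`):
  for any `f : ℕ → ℝ` whose consecutive gaps are antitone on `d ≥ 1` one has the secant bounds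
  `(n − m) Δ_n ≤ f n − f m ≤ (n − m) Δ_m` for `1 ≤ m ≤ n`, hence the tangent-line bound
  `f m ≤ f D + Δ_D (m − D)` for all `m, D ≥ 1`; summing over `b` and using `Δ_D ≥ 0`
  (`Literature.Combinatorics.Enumerative.log_factorial_div_mono`) and `∑_b d_b ≤ u D` gives the claim.
-/

noncomputable section

-- `Summit.ValiantsHypothesis.ValiantsHypothesis.…` is the tree's mandated layout (Sub = Summit).
set_option linter.dupNamespace false

namespace Summit.ValiantsHypothesis.ValiantsHypothesis.Theorems.DivisionGap.PerMultiplesHard.LogFactorialJensen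

open Finset Literature.Combinatorics.Enumerative
open scoped BigOperators

/-! ### Discrete concavity: gaps, secants and the tangent line -/

/-- If the consecutive gaps `f (d+1) - f d` of `f : ℕ → ℝ` are antitone for `d ≥ 1` (local form:
`f (d+2) - f (d+1) ≤ f (d+1) - f d` for `d ≥ 1`), then `f (y+1) - f y ≤ f (x+1) - f x` for
`1 ≤ x ≤ y`. [folklore] -/
theorem gap_le_gap_of_le (f : ℕ → ℝ)
    (hf : ∀ d : ℕ, 1 ≤ d → f (d + 2) - f (d + 1) ≤ f (d + 1) - f d) {x y : ℕ} (hx : 1 ≤ x)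
    (hxy : x ≤ y) : f (y + 1) - f y ≤ f (x + 1) - f x := by
  induction y, hxy using Nat.le_induction with
  | base => exact le_rfl
  | succ y hxy ih => exact (hf y (hx.trans hxy)).trans ih

/-- Upper secant bound for a discretely concave `f` (gaps antitone on `d ≥ 1`):
`f n - f m ≤ (n - m) · (f (m+1) - f m)` for `1 ≤ m ≤ n`. [folklore] -/
theorem sub_le_mul_gap (f : ℕ → ℝ)
    (hf : ∀ d : ℕ, 1 ≤ d → f (d + 2) - f (d + 1) ≤ f (d + 1) - f d) {m : ℕ} (hm : 1 ≤ m) {n : ℕ}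
    (hmn : m ≤ n) : f n - f m ≤ ((n : ℝ) - m) * (f (m + 1) - f m) := by
  induction n, hmn using Nat.le_induction with
  | base => simp
  | succ n hmn ih =>
    have h := gap_le_gap_of_le f hf hm hmn
    push_cast
    linarith

/-- Lower secant bound for a discretely concave `f` (gaps antitone on `d ≥ 1`):
`(n - m) · (f (n+1) - f n) ≤ f n - f m` for `1 ≤ m ≤ n`. [folklore] -/
theorem mul_gap_le_sub (f : ℕ → ℝ)
    (hf : ∀ d : ℕ, 1 ≤ d → f (d + 2) - f (d + 1) ≤ f (d + 1) - f d) {m : ℕ} (hm : 1 ≤ m) {n : ℕ}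
    (hmn : m ≤ n) : ((n : ℝ) - m) * (f (n + 1) - f n) ≤ f n - f m := by
  induction n, hmn using Nat.le_induction with
  | base => simp
  | succ n hmn ih =>
    have h := hf n (hm.trans hmn)
    have hnm : (m : ℝ) ≤ n := by exact_mod_cast hmn
    have h2 := mul_le_mul_of_nonneg_left h (by linarith : (0 : ℝ) ≤ (n : ℝ) + 1 - m)
    push_cast
    linarith

/-- Tangent-line bound for a discretely concave `f` (gaps antitone on `d ≥ 1`): for `D, m ≥ 1`,
`f m ≤ f D + (f (D+1) - f D) · (m - D)`. [folklore] -/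
theorem le_tangent_of_gap_succ_le (f : ℕ → ℝ)
    (hf : ∀ d : ℕ, 1 ≤ d → f (d + 2) - f (d + 1) ≤ f (d + 1) - f d) {D : ℕ} (hD : 1 ≤ D) {m : ℕ}
    (hm : 1 ≤ m) : f m ≤ f D + (f (D + 1) - f D) * ((m : ℝ) - D) := by
  rcases le_total D m with hDm | hmD
  · have := sub_le_mul_gap f hf hD hDm
    linarith
  · have := mul_gap_le_sub f hf hm hmD
    linarith

/-- Discrete Jensen from a tangent line: if `f m ≤ f D + s · (m - D)` for all `m ≥ 1` with a slope
`s ≥ 0`, then `∑_b f (d_b) ≤ u · f D` whenever `d_b ≥ 1` for all `b < u` and `∑_b d_b ≤ u · D`.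
[folklore] -/
theorem sum_le_card_mul_of_tangent (f : ℕ → ℝ) (D : ℕ) (s : ℝ) (hs : 0 ≤ s)
    (htan : ∀ m : ℕ, 1 ≤ m → f m ≤ f D + s * ((m : ℝ) - D)) (u : ℕ) (d : Fin u → ℕ)
    (hd : ∀ b, 1 ≤ d b) (hsum : ∑ b, d b ≤ u * D) : ∑ b, f (d b) ≤ (u : ℝ) * f D := by
  have h1 : ∑ b, f (d b) ≤ ∑ b, (f D + s * ((d b : ℝ) - D)) :=
    Finset.sum_le_sum fun b _ => htan (d b) (hd b)
  have h2 : ∑ b, (f D + s * ((d b : ℝ) - D)) = (u : ℝ) * f D + s * (∑ b, (d b : ℝ) - u * D) := by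
    rw [Finset.sum_add_distrib, Finset.sum_const, Finset.card_univ, Fintype.card_fin, nsmul_eq_mul,
      ← Finset.mul_sum, Finset.sum_sub_distrib, Finset.sum_const, Finset.card_univ, Fintype.card_fin,
      nsmul_eq_mul]
  have h3 : ∑ b, (d b : ℝ) ≤ (u : ℝ) * D := by exact_mod_cast hsum
  have h4 : s * (∑ b, (d b : ℝ) - u * D) ≤ 0 := mul_nonpos_of_nonneg_of_nonpos hs (by linarith)
  linarith

/-! ### Concavity of `log (d !) / d` on `d ≥ 1` -/

/-- Local concavity of `log`: `log (x+1) + log (x+3) ≤ 2 log (x+2)` for `x ≥ 0`, since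
`(x+1)(x+3) ≤ (x+2)²`. [folklore] -/
theorem log_add_one_add_log_add_three_le (x : ℝ) (hx : 0 ≤ x) :
    Real.log (x + 1) + Real.log (x + 3) ≤ 2 * Real.log (x + 2) := by
  rw [← Real.log_mul (by positivity) (by positivity)]
  have h2 : (2 : ℝ) * Real.log (x + 2) = Real.log ((x + 2) ^ 2) := by
    rw [Real.log_pow]
    norm_num
  rw [h2]
  exact Real.log_le_log (by positivity) (by nlinarith)

/-- The cleared-denominator form of the concavity of `log (d !) / d`:
`2 log (d !) ≤ d (d+3) log (d+1) − d (d+1) log (d+2)` for every `d : ℕ` (induction on `d`; the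
step is the local concavity of `log` at `d+1, d+2, d+3`). [folklore] -/
theorem two_mul_log_factorial_le (d : ℕ) :
    2 * Real.log (d.factorial : ℝ) ≤
      (d : ℝ) * ((d : ℝ) + 3) * Real.log ((d : ℝ) + 1) -
        (d : ℝ) * ((d : ℝ) + 1) * Real.log ((d : ℝ) + 2) := by
  induction d with
  | zero => simp
  | succ d ih =>
    have hconc := log_add_one_add_log_add_three_le (d : ℝ) (Nat.cast_nonneg d)
    have hmul := mul_le_mul_of_nonneg_left hconc
      (by positivity : (0 : ℝ) ≤ ((d : ℝ) + 1) * ((d : ℝ) + 2))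
    have e1 : ((d + 1 : ℕ) : ℝ) = (d : ℝ) + 1 := by push_cast; ring
    have e2 : (d : ℝ) + 1 + 1 = (d : ℝ) + 2 := by ring
    have e3 : (d : ℝ) + 1 + 2 = (d : ℝ) + 3 := by ring
    rw [log_factorial_succ, e1, e2, e3]
    linarith

/-- **Concavity of the Brégman exponent on `d ≥ 1`.**  With `γ(d) = log (d !) / d`:
`γ(d+2) − γ(d+1) ≤ γ(d+1) − γ(d)` for `d ≥ 1` (false at `d = 0`, where `γ(1) − γ(0) = 0 < γ(2) − γ(1)`).
[folklore] -/
theorem log_factorial_div_gap_succ_le (d : ℕ) (hd : 1 ≤ d) :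
    Real.log ((d + 2).factorial : ℝ) / ((d + 2 : ℕ) : ℝ) -
        Real.log ((d + 1).factorial : ℝ) / ((d + 1 : ℕ) : ℝ) ≤
      Real.log ((d + 1).factorial : ℝ) / ((d + 1 : ℕ) : ℝ) -
        Real.log (d.factorial : ℝ) / (d : ℝ) := by
  have key := two_mul_log_factorial_le d
  have hd' : (0 : ℝ) < d := by exact_mod_cast hd
  have e1 : ((d + 1 : ℕ) : ℝ) = (d : ℝ) + 1 := by push_cast; ring
  have e2 : ((d + 2 : ℕ) : ℝ) = (d : ℝ) + 2 := by push_cast; ring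
  rw [show (d + 2).factorial = (d + 1 + 1).factorial from rfl, log_factorial_succ (d + 1),
    log_factorial_succ d, e1, e2]
  rw [div_sub_div _ _ (by positivity) (by positivity), div_sub_div _ _ (by positivity) hd'.ne',
    div_le_div_iff₀ (by positivity) (by positivity)]
  have hmul : (0 : ℝ) ≤ ((d : ℝ) + 1) *
      ((d : ℝ) * ((d : ℝ) + 3) * Real.log ((d : ℝ) + 1) -
        (d : ℝ) * ((d : ℝ) + 1) * Real.log ((d : ℝ) + 2) - 2 * Real.log (d.factorial : ℝ)) :=
    mul_nonneg (by positivity) (by linarith)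
  linarith

/-! ### The stub -/

/-- **stub_logFactorialJensen — Jensen for the Brégman exponent.**  For integers `d_b ≥ 1`
(`b < u`) with `∑_b d_b ≤ u · D` and `D ≥ 1`:  `∑_b log (d_b !) / d_b ≤ u · log (D !) / D`.
The exponent `γ(d) = log (d !) / d` is monotone
(`Literature.Combinatorics.Enumerative.log_factorial_div_mono`) and concave on `d ≥ 1`
(`log_factorial_div_gap_succ_le`), so it lies below its tangent line at `D`
(`le_tangent_of_gap_succ_le`) whose slope `γ(D+1) − γ(D)` is nonnegative; summing the tangent
bound over `b` gives the claim (`sum_le_card_mul_of_tangent`). [folklore] -/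
theorem stub_logFactorialJensen :
    ∀ (u D : ℕ) (d : Fin u → ℕ), 1 ≤ D → (∀ b, 1 ≤ d b) → ∑ b, d b ≤ u * D →
      ∑ b, Real.log (((d b).factorial : ℕ) : ℝ) / ((d b : ℕ) : ℝ) ≤
        (u : ℝ) * (Real.log ((D.factorial : ℕ) : ℝ) / ((D : ℕ) : ℝ)) := by
  intro u D d hD hd hsum
  have hs : 0 ≤ Real.log ((D + 1).factorial : ℝ) / ((D + 1 : ℕ) : ℝ) -
      Real.log (D.factorial : ℝ) / (D : ℝ) :=
    sub_nonneg.mpr (log_factorial_div_mono (Nat.le_succ D))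
  exact sum_le_card_mul_of_tangent (fun m : ℕ => Real.log (m.factorial : ℝ) / (m : ℝ)) D _ hs
    (fun m hm => le_tangent_of_gap_succ_le (fun m : ℕ => Real.log (m.factorial : ℝ) / (m : ℝ))
      log_factorial_div_gap_succ_le hD hm) u d hd hsum

end Summit.ValiantsHypothesis.ValiantsHypothesis.Theorems.DivisionGap.PerMultiplesHard.LogFactorialJensen

end
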